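import Summits.AtomisticToContinuum.FouriersLaw.Theses.EmbeddedDrudeMourre

/-!
# `EmbeddedDrudeMourre.Assembly` — proved

Item `stmt-AtomisticToContinuum-12601` (assembly, rank 1, route `EmbeddedDrudeMourre`, sub-problem
`FouriersLaw`):

`DrudeDissolution → AbelOfSpectralDensity → GreenKuboContinuation → AbelThermodynamicLimit →
NessUnique → FiniteResponseOfUnique → FouriersLaw`.

This is literally the type of the route file's sorry-free deciding theorem
`Summit.AtomisticToContinuum.FouriersLaw.Theses.EmbeddedDrudeMourre.closes` (same six hypotheses,
same order, conclusion the sub-problem statement `FouriersLaw` by name). Its mathematics, for the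
record: clause (i) of `FouriersLawFor` from the proved existence fact
`pinnedChain_exists_isSteadyState` (Cuneo–Eckmann–Hairer–Rey-Bellet 2018, Thm 2.13) plus weak-NESS
uniqueness `NessUnique`; clause (ii): `DrudeDissolution` gives, below some `T₀ > 0`, a Gibbs state,
a measure-preserving infinite-volume dynamics and a current spectral measure `σ_T` with a continuous
non-negative window density `g_T`, `g_T 0 > 0`; `AbelOfSpectralDensity` (Poisson kernel) turns it
into the Abelian Green–Kubo witness `κ = (T²)⁻¹ (π g_T 0) > 0`; `GreenKuboContinuation` extends the
witness to every `T > 0`; `AbelThermodynamicLimit` (fed uniqueness) yields `κ(T) > 0` with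
`D_N → κ(T)` for every steady-state family and every response sequence, the latter supplied by
`FiniteResponseOfUnique`. Nothing beyond `closes` is used; axioms are those of `closes`
(`propext`, `Classical.choice`, `Quot.sound`).
-/

namespace Summit.AtomisticToContinuum.FouriersLaw.Theorems.EmbeddedDrudeMourre

/-- **Assembly of route `EmbeddedDrudeMourre`** (item `stmt-AtomisticToContinuum-12601`):
`DrudeDissolution → AbelOfSpectralDensity → GreenKuboContinuation → AbelThermodynamicLimit →
NessUnique → FiniteResponseOfUnique → FouriersLaw`.
Proof: unfold `Assembly` and apply the route's sorry-free deciding theorem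
`Theses.EmbeddedDrudeMourre.closes`, whose type it is verbatim. [folklore] -/
theorem assembly_proof :
    Summit.AtomisticToContinuum.FouriersLaw.Theses.EmbeddedDrudeMourre.Assembly := by
  unfold Summit.AtomisticToContinuum.FouriersLaw.Theses.EmbeddedDrudeMourre.Assembly
  exact Summit.AtomisticToContinuum.FouriersLaw.Theses.EmbeddedDrudeMourre.closes

end Summit.AtomisticToContinuum.FouriersLaw.Theorems.EmbeddedDrudeMourre
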